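import Literature.Analysis.Complex.PQExhaustionZero
import Literature.Analysis.Complex.OpensFlat
import Literature.Analysis.Complex.DolbeaultInvariance
import Mathlib.Topology.Algebra.Module.FiniteDimension
import HarnessLib

/-!
# `H^{p,q}_{∂̄} = 0` (`q ≥ 1`) for polydiscs in `ℂ^ι` and for finite-dimensional complex vector spaces

**Theorem** (`subsingleton_dolbeaultCohomology_polydisc`). For every polydisc
`D = D(c, r) ⊆ ℂ^ι` (as an open submanifold of `ℂ^ι = ι → ℂ`) and all `p, q`, the tree's Dolbeault
cohomology `H^{p,q+1}_{∂̄}(D)` (`Literature.NumberTheory.Transcendental.dolbeaultCohomology`)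
vanishes: every `∂̄`-closed smooth `(p,q+1)`-form on `D` is `∂̄` of a smooth `(p,q)`-form on `D`
(`dolbeaultBar_exact_polydisc`); likewise `H^{p,q+1}_{∂̄}(ℂ^ι) = 0`
(`subsingleton_dolbeaultCohomology_top`) and, transporting along a linear isomorphism
`E ≃L[ℂ] ℂ^{dim E}` (`Literature/Analysis/Complex/DolbeaultInvariance.lean`),
**`H^{p,q+1}_{∂̄}(E) = 0` for every finite-dimensional complex normed space `E`**
(`subsingleton_dolbeaultCohomology_top_of_finiteDimensional`) — the case `U = ⊤` of the tree's
named fact `Literature.NumberTheory.Transcendental.subsingleton_dolbeaultCohomology_of_convex` —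
and `H^{p,q+1}_{∂̄}(Φ⁻¹(D)) = 0` for coordinate polydiscs `Φ⁻¹(D) ⊆ E`, `Φ : E ≃L[ℂ] ℂ^ι`
(`subsingleton_dolbeaultCohomology_preimagePolydisc`). Both go through `subsingleton_dolbeaultCohomology_of_flatDbarSolver`: a flat
`∂̄`-solver on the open set `U` (spelled out as a hypothesis) gives `H^{p,q+1}_{∂̄}(U) = 0`.

This is the polydisc case (in `ℂ^ι`) of the tree's named fact
`Literature.NumberTheory.Transcendental.subsingleton_dolbeaultCohomology_of_convex`
(Hörmander (1973), Thm. 2.7.8 with 2.3.3; Voisin (2002), Prop. 2.36), assembled from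

* `Literature.Analysis.Complex.exists_dbar_potential_on_polydisc(_zero)` — the flat statements
  (Hörmander 2.3.3 + the exhaustion of 2.7.8, `Literature/Analysis/Complex/PQExhaustion(Zero).lean`,
  the bidegree `(p,1)` via entire approximation of the holomorphic corrections);
* the dictionary forms-on-`U` / flat maps of `Literature/Analysis/Complex/OpensFlat.lean`;
* the identification `∂̄α = (dα)^{p,q+1}` on forms of pure type
  (`IsOfType.dolbeaultBar_eq`, discharged in the tree).

The remaining cases of the fact (a general finite-dimensional `E` instead of `ℂ^ι`, and convex
`U` other than polydiscs, which needs Hörmander 2.7.5–2.7.8 or the `L²` method) are not treated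
here.

## References

* L. Hörmander, *An Introduction to Complex Analysis in Several Variables*, 2nd ed. (1973),
  Thm. 2.3.3, Thm. 2.7.8. [HormanderSCV1973]
* C. Voisin, *Hodge Theory and Complex Algebraic Geometry I* (2002), Prop. 2.36. [Voisin2002]
-/

noncomputable section

open scoped Manifold ContDiff Topology
open Set Filter Function
open Literature.Geometry.Kaehler Literature.NumberTheory.Transcendental

namespace Literature.Analysis.Complex

variable {ι : Type*} [Fintype ι] [DecidableEq ι]

/-- A polydisc of `ℂ^ι` as an open subset. [folklore] -/
def polydiscOpens (c : ι → ℂ) (r : ι → ℝ) : TopologicalSpace.Opens (ι → ℂ) :=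
  ⟨polydisc c r, isOpen_polydisc c r⟩

omit [DecidableEq ι] in
/-- The carrier of `polydiscOpens`. [folklore] -/
@[simp]
theorem coe_polydiscOpens (c : ι → ℂ) (r : ι → ℝ) :
    (polydiscOpens c r : Set (ι → ℂ)) = polydisc c r :=
  rfl

omit [DecidableEq ι] in
/-- Membership in `polydiscOpens`. [folklore] -/
@[simp]
theorem mem_polydiscOpens {c : ι → ℂ} {r : ι → ℝ} {z : ι → ℂ} :
    z ∈ polydiscOpens c r ↔ z ∈ polydisc c r :=
  Iff.rfl

/-! ### From a flat `∂̄`-solver on `U` to the vanishing of `H^{p,q+1}_{∂̄}(U)` -/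

/-- **Polydiscs carry a flat `∂̄`-solver in every bidegree `(p,q+1)`** (Hörmander (1973),
Thm. 2.7.8 on polydiscs: `exists_dbar_potential_on_polydisc_zero` for `q = 0`,
`exists_dbar_potential_on_polydisc` for `q ≥ 1`). [cite: HormanderSCV1973, Thm. 2.7.8] -/
theorem flatDbarSolver_polydisc (c : ι → ℂ) (r : ι → ℝ) (p q : ℕ) :
    (∀ ⦃α : (ι → ℂ) → (ι → ℂ) [⋀^Fin (p + q + 1)]→L[ℝ] ℂ⦄, ContDiffOn ℝ ∞ α (polydisc c r) →
      (∀ x ∈ polydisc c r, IsOfTypeAt p (q + 1) (α x)) →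
      (∀ x ∈ polydisc c r, typeProjAt p (q + 2) (extDeriv α x) = 0) →
      ∃ β : (ι → ℂ) → (ι → ℂ) [⋀^Fin (p + q)]→L[ℝ] ℂ, ContDiffOn ℝ ∞ β (polydisc c r) ∧
        (∀ x, typeProjAt p q (β x) = β x) ∧ ∀ x ∈ polydisc c r, typeProjAt p (q + 1) (extDeriv β x) = α x) := by
  intro α hα htype hclosed
  cases q with
  | zero => exact exists_dbar_potential_on_polydisc_zero hα htype hclosed
  | succ q => exact exists_dbar_potential_on_polydisc hα htype hclosed

/-- **`ℂ^ι` carries a flat `∂̄`-solver in every bidegree `(p,q+1)`** (Hörmander (1973),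
Thm. 2.7.8 for `Ω = ℂⁿ`). [cite: HormanderSCV1973, Thm. 2.7.8] -/
theorem flatDbarSolver_univ (p q : ℕ) :
    (∀ ⦃α : (ι → ℂ) → (ι → ℂ) [⋀^Fin (p + q + 1)]→L[ℝ] ℂ⦄, ContDiffOn ℝ ∞ α (univ : Set (ι → ℂ)) →
      (∀ x ∈ (univ : Set (ι → ℂ)), IsOfTypeAt p (q + 1) (α x)) →
      (∀ x ∈ (univ : Set (ι → ℂ)), typeProjAt p (q + 2) (extDeriv α x) = 0) →
      ∃ β : (ι → ℂ) → (ι → ℂ) [⋀^Fin (p + q)]→L[ℝ] ℂ, ContDiffOn ℝ ∞ β (univ : Set (ι → ℂ)) ∧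
        (∀ x, typeProjAt p q (β x) = β x) ∧ ∀ x ∈ (univ : Set (ι → ℂ)), typeProjAt p (q + 1) (extDeriv β x) = α x) := by
  intro α hα htype hclosed
  cases q with
  | zero =>
    obtain ⟨β, hβ, hβf, hβα⟩ := exists_dbar_potential_on_univ_zero (contDiffOn_univ.1 hα)
      (fun x => htype x (mem_univ x)) (fun x => hclosed x (mem_univ x))
    exact ⟨β, hβ.contDiffOn, hβf, fun x _ => hβα x⟩
  | succ q =>
    obtain ⟨β, hβ, hβf, hβα⟩ := exists_dbar_potential_on_univ (contDiffOn_univ.1 hα)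
      (fun x => htype x (mem_univ x)) (fun x => hclosed x (mem_univ x))
    exact ⟨β, hβ.contDiffOn, hβf, fun x _ => hβα x⟩

omit [DecidableEq ι] in
/-- **`∂̄`-exactness from a flat solver**: on an open `U ⊆ ℂ^ι` with a flat `∂̄`-solver in bidegree
`(p,q+1)` (hypothesis `hS`: every `α : ℂ^ι → Λ^{p+q+1}`, `C^∞` on `U`, of type `(p,q+1)` on `U` with
`(dα)^{p,q+2} = 0` on `U`, is `(dβ)^{p,q+1}` on `U` for some `β`, `C^∞` on `U` and fixed by the
`(p,q)`-projection), every smooth `(p,q+1)`-form `α` on the manifold `U` with `∂̄α = 0` is `∂̄β` for a smooth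
`(p,q)`-form `β` on `U` (transport through `Literature/Analysis/Complex/OpensFlat.lean` and the
tree's `IsOfType.dolbeaultBar_eq`). [cite: HormanderSCV1973, Thm. 2.7.8] -/
theorem dolbeaultBar_exact_of_flatDbarSolver {U : TopologicalSpace.Opens (ι → ℂ)} {p q : ℕ}
    (hS : (∀ ⦃α : (ι → ℂ) → (ι → ℂ) [⋀^Fin (p + q + 1)]→L[ℝ] ℂ⦄, ContDiffOn ℝ ∞ α (U : Set (ι → ℂ)) →
      (∀ x ∈ (U : Set (ι → ℂ)), IsOfTypeAt p (q + 1) (α x)) →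
      (∀ x ∈ (U : Set (ι → ℂ)), typeProjAt p (q + 2) (extDeriv α x) = 0) →
      ∃ β : (ι → ℂ) → (ι → ℂ) [⋀^Fin (p + q)]→L[ℝ] ℂ, ContDiffOn ℝ ∞ β (U : Set (ι → ℂ)) ∧
        (∀ x, typeProjAt p q (β x) = β x) ∧ ∀ x ∈ (U : Set (ι → ℂ)), typeProjAt p (q + 1) (extDeriv β x) = α x))
    {α : MForm 𝓘(ℝ, ι → ℂ) U ℂ (p + (q + 1))} (hs : IsSmoothForm α)
    (ht : IsOfType p (q + 1) α) (hc : dolbeaultBar α = 0) :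
    ∃ β : MForm 𝓘(ℝ, ι → ℂ) U ℂ (p + q), IsSmoothForm β ∧ IsOfType p q β ∧ dolbeaultBar β = α := by
  -- the flat data
  have hα : ContDiffOn ℝ ∞ (flatExt α) U := (isSmoothForm_iff_contDiffOn_flatExt α).1 hs
  have hαt : ∀ x ∈ (U : Set (ι → ℂ)), IsOfTypeAt p (q + 1) (flatExt α x) := fun x hx => by
    rw [← show (((⟨x, hx⟩ : U) : ι → ℂ)) = x from rfl, flatExt_coe]
    exact ((isOfType_iff_forall_isOfTypeAt_opens p (q + 1) α).1 ht).2 ⟨x, hx⟩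
  have hαc : ∀ x ∈ (U : Set (ι → ℂ)), typeProjAt p (q + 2) (extDeriv (flatExt α) x) = 0 := by
    intro x hx
    have h1 := congr_fun (IsOfType.dolbeaultBar_eq_holds ht) ⟨x, hx⟩
    rw [hc] at h1
    rw [← mextDeriv_apply_eq_extDeriv_flatExt α ⟨x, hx⟩, typeComponent_apply_opens]
    exact h1.symm
  -- the flat potential on all of `U`
  obtain ⟨b, hb, hbt, hbα⟩ := hS hα hαt hαc
  have hβt : IsOfType p q (restrictOpens U b) :=
    isOfType_restrictOpens rfl fun y _ => (isOfTypeAt_iff_typeProjAt_eq_self rfl _).2 (hbt y)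
  refine ⟨restrictOpens U b, isSmoothForm_restrictOpens hb, hβt, ?_⟩
  rw [IsOfType.dolbeaultBar_eq_holds hβt]
  funext x
  rw [← typeComponent_apply_opens, mextDeriv_restrictOpens_apply, hbα x x.2]
  exact flatExt_coe α x

omit [DecidableEq ι] in
/-- **`H^{p,q+1}_{∂̄}(U) = 0` from a flat solver.** [cite: HormanderSCV1973, Thm. 2.7.8] -/
theorem subsingleton_dolbeaultCohomology_of_flatDbarSolver {U : TopologicalSpace.Opens (ι → ℂ)}
    {p q : ℕ} (hS : (∀ ⦃α : (ι → ℂ) → (ι → ℂ) [⋀^Fin (p + q + 1)]→L[ℝ] ℂ⦄, ContDiffOn ℝ ∞ α (U : Set (ι → ℂ)) →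
      (∀ x ∈ (U : Set (ι → ℂ)), IsOfTypeAt p (q + 1) (α x)) →
      (∀ x ∈ (U : Set (ι → ℂ)), typeProjAt p (q + 2) (extDeriv α x) = 0) →
      ∃ β : (ι → ℂ) → (ι → ℂ) [⋀^Fin (p + q)]→L[ℝ] ℂ, ContDiffOn ℝ ∞ β (U : Set (ι → ℂ)) ∧
        (∀ x, typeProjAt p q (β x) = β x) ∧ ∀ x ∈ (U : Set (ι → ℂ)), typeProjAt p (q + 1) (extDeriv β x) = α x)) :
    Subsingleton (dolbeaultCohomology (ι → ℂ) U p (q + 1)) := by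
  unfold dolbeaultCohomology
  rw [Submodule.Quotient.subsingleton_iff, eq_top_iff]
  rintro ⟨z, hz⟩ -
  rw [Submodule.mem_comap, Submodule.subtype_apply]
  refine Submodule.span_le.2 ?_ hz
  rintro α ⟨hs, ht, hc⟩
  obtain ⟨β, hβs, hβt, hβ⟩ := dolbeaultBar_exact_of_flatDbarSolver hS hs ht hc
  exact Submodule.subset_span ⟨β, (mem_pqForms_iff β).2 ⟨hβs, hβt⟩, hβ⟩

/-! ### The theorems -/

/-- **`∂̄`-exactness on polydiscs in bidegree `(p,q+1)`**: a smooth `(p,q+1)`-form `α` on the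
polydisc `D ⊆ ℂ^ι` with `∂̄α = 0` is `∂̄β` for a smooth `(p,q)`-form `β` on `D`
(Hörmander (1973), Thm. 2.7.8 on polydiscs / Voisin (2002), Prop. 2.36).
[cite: HormanderSCV1973, Thm. 2.7.8] -/
theorem dolbeaultBar_exact_polydisc {c : ι → ℂ} {r : ι → ℝ} {p q : ℕ}
    {α : MForm 𝓘(ℝ, ι → ℂ) (polydiscOpens c r) ℂ (p + (q + 1))} (hs : IsSmoothForm α)
    (ht : IsOfType p (q + 1) α) (hc : dolbeaultBar α = 0) :
    ∃ β : MForm 𝓘(ℝ, ι → ℂ) (polydiscOpens c r) ℂ (p + q),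
      IsSmoothForm β ∧ IsOfType p q β ∧ dolbeaultBar β = α :=
  dolbeaultBar_exact_of_flatDbarSolver (flatDbarSolver_polydisc c r p q) hs ht hc

/-- **`H^{p,q+1}_{∂̄}(D) = 0` for polydiscs `D ⊆ ℂ^ι`** (Hörmander (1973), Thm. 2.7.8 with 2.3.3;
Voisin (2002), Prop. 2.36; the polydisc-in-`ℂ^ι` case of
`Literature.NumberTheory.Transcendental.subsingleton_dolbeaultCohomology_of_convex`, all
`q ≥ 1`). [cite: HormanderSCV1973, Thm. 2.7.8] -/
theorem subsingleton_dolbeaultCohomology_polydisc (c : ι → ℂ) (r : ι → ℝ) (p q : ℕ) :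
    Subsingleton (dolbeaultCohomology (ι → ℂ) (polydiscOpens c r) p (q + 1)) :=
  subsingleton_dolbeaultCohomology_of_flatDbarSolver (flatDbarSolver_polydisc c r p q)

/-- **`H^{p,q+1}_{∂̄}(ℂ^ι) = 0`** (Hörmander (1973), Thm. 2.7.8 for `Ω = ℂⁿ`; the case `U = ⊤`,
`E = ℂ^ι` of `Literature.NumberTheory.Transcendental.subsingleton_dolbeaultCohomology_of_convex`,
all `q ≥ 1`). [cite: HormanderSCV1973, Thm. 2.7.8] -/
theorem subsingleton_dolbeaultCohomology_top (p q : ℕ) :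
    Subsingleton (dolbeaultCohomology (ι → ℂ) (⊤ : TopologicalSpace.Opens (ι → ℂ)) p (q + 1)) :=
  subsingleton_dolbeaultCohomology_of_flatDbarSolver (by
    simpa only [TopologicalSpace.Opens.coe_top] using flatDbarSolver_univ (ι := ι) p q)

omit [Fintype ι] [DecidableEq ι] in
/-- **`H^{p,q+1}_{∂̄}(E) = 0` for every finite-dimensional complex normed space `E`** (as the open
submanifold `⊤`; Hörmander (1973), Thm. 2.7.8 for the Runge domain `Ω = ℂⁿ`, transported along a
continuous linear isomorphism `E ≃L[ℂ] ℂⁿ`, `subsingleton_dolbeaultCohomology_top_of_equiv`). This is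
the case `U = ⊤` of the tree's named fact
`Literature.NumberTheory.Transcendental.subsingleton_dolbeaultCohomology_of_convex`.
[cite: HormanderSCV1973, Thm. 2.7.8] -/
theorem subsingleton_dolbeaultCohomology_top_of_finiteDimensional (E : Type*) [NormedAddCommGroup E]
    [NormedSpace ℂ E] [FiniteDimensional ℂ E] (p q : ℕ) :
    Subsingleton (dolbeaultCohomology E (⊤ : TopologicalSpace.Opens E) p (q + 1)) := by
  have hd : Module.finrank ℂ E = Module.finrank ℂ (Fin (Module.finrank ℂ E) → ℂ) := by
    rw [Module.finrank_fin_fun]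
  exact subsingleton_dolbeaultCohomology_top_of_equiv (ContinuousLinearEquiv.ofFinrankEq hd)
    (subsingleton_dolbeaultCohomology_top (ι := Fin (Module.finrank ℂ E)) p q)

/-! ### Linear images: polydiscs with respect to a basis of a finite-dimensional space -/

section Image

variable {E : Type*} [NormedAddCommGroup E] [NormedSpace ℂ E]
  {E' : Type*} [NormedAddCommGroup E'] [NormedSpace ℂ E']

/-- The map between open submanifolds `U ⊆ E`, `V ⊆ E'` induced by a map `φ` of the model spaces
with `φ(U) ⊆ V`. [folklore] -/
def opensMap {U : TopologicalSpace.Opens E} {V : TopologicalSpace.Opens E'} (φ : E → E')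
    (h : MapsTo φ U V) : U → V :=
  fun x => ⟨φ x, h x.2⟩

omit [NormedSpace ℂ E] [NormedSpace ℂ E'] in
/-- Values of `opensMap`. [folklore] -/
@[simp]
theorem coe_opensMap {U : TopologicalSpace.Opens E} {V : TopologicalSpace.Opens E'} (φ : E → E')
    (h : MapsTo φ U V) (x : U) : (opensMap φ h x : E') = φ x :=
  rfl

/-- `opensMap φ h` is complex-`C^∞` if `φ` is. [folklore] -/
theorem contMDiff_opensMap {U : TopologicalSpace.Opens E} {V : TopologicalSpace.Opens E'} {φ : E → E'}
    (hφ : ContMDiff 𝓘(ℂ, E) 𝓘(ℂ, E') ∞ φ) (h : MapsTo φ U V) :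
    ContMDiff 𝓘(ℂ, E) 𝓘(ℂ, E') ∞ (opensMap φ h) := fun x =>
  (ContMDiffAt.subtypeVal_comp_iff V (opensMap φ h) x).1
    ((contMDiffAt_subtype_iff (U := U) (f := φ)).2 hφ.contMDiffAt)

/-- `opensMap φ h` is real-`C^∞` if `φ` is. [folklore] -/
theorem contMDiff_real_opensMap {U : TopologicalSpace.Opens E} {V : TopologicalSpace.Opens E'}
    {φ : E → E'} (hφ : ContMDiff 𝓘(ℝ, E) 𝓘(ℝ, E') ∞ φ) (h : MapsTo φ U V) :
    ContMDiff 𝓘(ℝ, E) 𝓘(ℝ, E') ∞ (opensMap φ h) := fun x =>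
  (ContMDiffAt.subtypeVal_comp_iff V (opensMap φ h) x).1
    ((contMDiffAt_subtype_iff (U := U) (f := φ)).2 hφ.contMDiffAt)

/-- **Transport of `H^{p,q+1}_{∂̄} = 0` along a continuous linear equivalence**, for open sets
corresponding under it: if `Φ : E ≃L[ℂ] E'`, `U = Φ⁻¹(V)` and `H^{p,q+1}_{∂̄}(V) = 0`, then
`H^{p,q+1}_{∂̄}(U) = 0` (`subsingleton_dolbeaultCohomology_of_leftInverse` with the restrictions of
`Φ` and `Φ⁻¹`). [cite: VoisinHodgeI2002, §7.3.2] -/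
theorem subsingleton_dolbeaultCohomology_of_equiv_preimage (Φ : E ≃L[ℂ] E')
    {U : TopologicalSpace.Opens E} {V : TopologicalSpace.Opens E'} (hUV : ∀ x, x ∈ U ↔ Φ x ∈ V)
    {p q : ℕ} (hV : Subsingleton (dolbeaultCohomology E' V p (q + 1))) :
    Subsingleton (dolbeaultCohomology E U p (q + 1)) := by
  have hf : MapsTo (Φ : E → E') U V := fun x hx => (hUV x).1 hx
  have hg : MapsTo (Φ.symm : E' → E) V U := fun y hy => (hUV _).2 (by simpa using hy)
  exact subsingleton_dolbeaultCohomology_of_leftInverse (f := opensMap (Φ : E → E') hf)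
    (g := opensMap (Φ.symm : E' → E) hg)
    ((contMDiff_opensMap (Φ : E →L[ℂ] E').contMDiff hf).mdifferentiable (by simp))
    (contMDiff_real_opensMap ((Φ : E →L[ℂ] E').restrictScalars ℝ).contMDiff hf)
    ((contMDiff_opensMap (Φ.symm : E' →L[ℂ] E).contMDiff hg).mdifferentiable (by simp))
    (contMDiff_real_opensMap ((Φ.symm : E' →L[ℂ] E).restrictScalars ℝ).contMDiff hg)
    (fun x => Subtype.ext (Φ.symm_apply_apply x.1)) hV

/-- The preimage of a polydisc of `ℂ^ι` under a continuous linear equivalence `E ≃L[ℂ] ℂ^ι` (a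
"polydisc with respect to complex linear coordinates" of `E`), as an open subset. [folklore] -/
def preimagePolydiscOpens {ι : Type*} [Fintype ι] (Φ : E ≃L[ℂ] (ι → ℂ)) (c : ι → ℂ) (r : ι → ℝ) :
    TopologicalSpace.Opens E :=
  ⟨Φ ⁻¹' polydisc c r, (isOpen_polydisc c r).preimage Φ.continuous⟩

omit [NormedSpace ℂ E'] in
/-- Membership in `preimagePolydiscOpens`. [folklore] -/
@[simp]
theorem mem_preimagePolydiscOpens {ι : Type*} [Fintype ι] (Φ : E ≃L[ℂ] (ι → ℂ)) (c : ι → ℂ)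
    (r : ι → ℝ) (x : E) : x ∈ preimagePolydiscOpens Φ c r ↔ Φ x ∈ polydisc c r :=
  Iff.rfl

/-- **`H^{p,q+1}_{∂̄} = 0` for coordinate polydiscs of a finite-dimensional complex vector space**:
for a continuous linear equivalence `Φ : E ≃L[ℂ] ℂ^ι` and a polydisc `D ⊆ ℂ^ι`, the Dolbeault
cohomology `H^{p,q+1}_{∂̄}(Φ⁻¹(D))` vanishes (Hörmander (1973), Thm. 2.7.8 on the polydisc,
transported along `Φ`; these `U = Φ⁻¹(D)` are convex open subsets of `E`, instances of
`Literature.NumberTheory.Transcendental.subsingleton_dolbeaultCohomology_of_convex`).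
[cite: HormanderSCV1973, Thm. 2.7.8] -/
theorem subsingleton_dolbeaultCohomology_preimagePolydisc {ι : Type*} [Fintype ι] [DecidableEq ι]
    (Φ : E ≃L[ℂ] (ι → ℂ)) (c : ι → ℂ) (r : ι → ℝ) (p q : ℕ) :
    Subsingleton (dolbeaultCohomology E (preimagePolydiscOpens Φ c r) p (q + 1)) :=
  subsingleton_dolbeaultCohomology_of_equiv_preimage Φ (V := polydiscOpens c r) (fun _ => Iff.rfl)
    (subsingleton_dolbeaultCohomology_polydisc c r p q)

end Image

end Literature.Analysis.Complex
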